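import Literature.NumberTheory.EllipticCurves.Kobayashi2003.SignedColemanKatoZeta
import HarnessLib

/-!
# Kobayashi 2003, Thm. 6.2 (6.13)/(6.14) + Thm. 6.3 + Thm. 7.3 i) (7.21) at the trivial character, with
# Kato's Thm. 12.6 zeta submodule — the PRINT-EXACT reading of the Poitou–Tate sequence (7.21) on the
# pinned duals: `X^ε(E/ℚ_∞)` and `X₀(E/ℚ_∞)` with their CONTRAGREDIENT `Λ`-structure
# (`D : SignedSelmerDualData W κ γ⁻¹ ε`, `Y : W.FineSelmerDualData κ γ⁻¹` against
# `I : Kato2004.IwasawaH1Data W p κ γ`)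

Topic `NumberTheory/EllipticCurves`, sub-directory `Kobayashi2003` (namespace = path). Sibling of
`SignedColemanKatoZeta` (cell `bsd-ssimc`: hypothesis structure `SignedColemanKatoData` + construction
fact `thm62_63_73_signedColemanKato_zeta`), whose vocabulary, fields and docstrings are used unchanged
except for ONE field. THIS FILE: one hypothesis STRUCTURE (`SignedColemanKatoDataContra`: the sibling's
fields VERBATIM, except that the Poitou–Tate field `exact` quantifies over the dual data with generator
argument `γ⁻¹`) and ONE named CONSTRUCTION fact (`def … : Prop`, D-0014; nothing asserted, no
`_holds`) saying it is inhabited. No instance, no notation, no attribute. Typed by a Literature typer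
(cell `bsd-stepL`, guest service) following the convention audit of the cell `bsd-wall` (crux K3
`SignedKatoDivisibilityUpToAtTwo`, `G4-CONVENTION-AUDIT.md` §0 and §3 (b): "the named fact
`Kobayashi2003.thm62_63_73_signedColemanKato_zeta` (field `exact`) … is the PRINT statement TWISTED by
`ι` on one side … deserve the same audit by a typer"; second reader `W3G2-READER-G4-AUDIT.md`: "same for
… `Kobayashi2003.thm62_63_73_…` field `exact`"). HONEST FRAMING: a TRANSCRIPTION; nothing of Kobayashi
or Kato is proved here; BSD is not proved by any of this; nothing is booked.

## The point (the `Λ`-module structure on the two Pontryagin duals in (7.21))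

Kobayashi's (7.21) (p. 13), `0 → 𝐇¹(T) → 𝐇¹_Iw(T)/𝐇¹_{Iw,ε}(T) → X^ε(E/K_∞) → X⁰(E/K_∞) → 0`, is an
exact sequence of `Λ`-modules obtained from Poitou–Tate duality along the tower ((7.17)–(7.20),
following Kurihara; Kato (14.9.3), (17.13.1) "a sequence of `Λ`-modules"), the middle arrow composed here
with the Coleman isomorphism (6.13)/(6.14). Iwasawa cohomology (`𝐇¹`, `𝐇¹_Iw`) carries the natural
(covariant) action [Kato §12.2]; the tree pins it as `I : Kato2004.IwasawaH1Data W p κ γ` with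
`T = conj_γ − 1` (`IwasawaH1Data.proj_T_smul`), `1 + T ↦ γ`, and the sibling's `col : I.H →ₗ[Λ] Λ` is
`Λ`-linear for it. The duality pairings being functorial (invariant under transport of structure by
`σ ∈ Gal(ℚ̄/ℚ)`), the duality maps carry the natural action to the CONTRAGREDIENT action
`x ↦ x ∘ conj_{σ⁻¹}` on the Pontryagin duals `X = Hom(Sel, ℚ_p/ℤ_p)` ("We denote the Pontryagin dual of
Selmer groups by "X"", Def. 2.1, p. 5). The tree's dual data `SignedSelmerDualData W κ γ' ε` /
`W.FineSelmerDualData κ γ'` have `T` acting by PRE-composition with `conj_{γ'}`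
(`SignedSelmerDualData.toDual_T_smul`, `FineSelmerDualData.toDual_T_smul`), i.e. the contragredient
action of `γ'⁻¹`; so with `1 + T ↦ γ` throughout, (7.21) is a sequence of `Λ`-LINEAR maps
`I.H →^{col} Λ → D.X → Y.X → 0` exactly for `D : SignedSelmerDualData W κ γ⁻¹ ε`,
`Y : W.FineSelmerDualData κ γ⁻¹` — the field `exact` below. The sibling quantifies over `D`, `Y` with `γ`
there (`(X^ε)^ι`, `(X⁰)^ι` in Greenberg's notation `S^ι`, `ι(γ) = γ⁻¹` [Greenberg1989, pp. 101–102]),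
for which the printed sequence gives `Λ`-linear maps out of `Λ` only after composing `col` with `ι`; the
two versions of `exact` agree iff the ideal `col(𝐇¹) ⊆ Λ` is `ι`-symmetric — NOT in print (the audit's
§1: "the tree fact is Kato's theorem iff … is `ι`-symmetric prime by prime"). The other fields (`col`,
`col_injective`, `Z`, `zeta_le_span`, `image_zeta_localized`) involve `𝐇¹` and ideals of `Λ` only and
are repeated VERBATIM. The sibling is NOT edited (D-0014); this file vendors the print-exact reading
under new names. READING FLAG `Kob03-721-dual-action` (the only new one): the derivation above —
the same as `Kato-134-dual-action` of `Kato2004/EulerSystemBoundFineSelmerTwoContragredient.lean`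
(module docstring: Kato §12.2 / §14.9 / §17.13 verbatim and the argument); all the sibling's flags
(`Kob03-eta1-Ftower`, `Kob03-63-eta1-ideal-localized`, `Kob03-721-eta1-maps-existential`) apply
verbatim.

## Source, verbatim (S. Kobayashi, Invent. Math. 152 (2003) 1–36 [Kobayashi2003], held copy
## `paper:doi-10-1007-s00222-002-0265-4`; the sibling's module docstring quotes §§2–7 in full)

Def. 2.1 (p. 5): "Following Kurihara [9], we also define the zero Selmer group by
`Sel⁰(E/K_n) := Ker(H¹(K_n, E[p^∞]) → ∏_v H¹(K_{n,v}, E[p^∞]))` and `Sel⁰(E/K_∞) := lim→_n Sel⁰(E/K_n)`.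
We denote the Pontryagin dual of Selmer groups by "X"." Thm. 7.3 (p. 13): "i) … we have an exact
sequence (7.21) `0 → 𝐇¹(T) → 𝐇¹_Iw(T)/𝐇¹_{Iw,±}(T) → X^±(E/K_∞) → X⁰(E/K_∞) → 0`."
K. Kato, Astérisque 295, §12.2 (p. 220): "`𝐇¹(T)` and `𝐇²(T)` are finitely generated
`ℤ_p[[G_∞]]`-modules"; §17.13 (p. 279): "we obtain a sequence of `Λ`-modules (17.13.1) …".
R. Greenberg, Adv. Stud. Pure Math. 17 (1989) pp. 101–102: "If `S` is any `Λ`-module, we define `S^ι` as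
the `Λ`-module with the same underlying set as `S` but with `Λ` acting through `ι`."

## What is NOT here (and why)

* NO edit of the sibling; NO claim that `SignedColemanKatoData` and `SignedColemanKatoDataContra` are
  equivalent (they differ by the unprinted `ι`-symmetry of `col(𝐇¹)`); NO conversion between them (the
  `γ ↦ γ⁻¹` twist of dual data lives Summits-side, `…IwasawaInvolutionCompat.lean` of cell `bsd-wall`).
* Everything the sibling lists under «NOT here»; no `_holds` (size XL).
-- TODO(general form): the `η ≠ 1` companion `EtaColemanPoitouTateData` / `thm62_63_73_etaColemanPoitouTate`
-- (`Kobayashi2003/EtaColemanPoitouTateSequences.lean`) and the `p = 2` ♯/♭ analogue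
-- (`Sprung2012/SharpFlatColemanKatoZeta.lean`) carry Poitou–Tate fields of the same shape and deserve
-- the same reading; not done here.

References: [Kobayashi2003] Def. 1.1 (p. 2), Def. 2.1 (p. 5), Thm. 6.2 (6.13)–(6.14), Thm. 6.3 (p. 11),
(7.17)–(7.21), Prop. 7.1, Thm. 7.3 (pp. 12–13); [Kato2004Asterisque] §12.2 (p. 220), Thm. 12.6 (p. 222),
Ex. 13.3 (p. 225), §14.9 (p. 239), §17.13 (p. 279); [Greenberg1989] pp. 101–102; tree:
`Kobayashi2003/SignedColemanKatoZeta.lean` (sibling), `Kobayashi2003/SignedSelmer.lean`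
(`SignedSelmerDualData.toDual_T_smul`), `KatoFineSelmerDual.lean`, `Kato2004/IwasawaCohomology.lean`,
`Kato2004/EulerSystemBoundFineSelmerTwoContragredient.lean` (flag `Kato-134-dual-action`),
`IwasawaAlgebraInvolution.lean`.
-/

noncomputable section

open scoped MatrixGroups ModularForm

open CongruenceSubgroup WeierstrassCurve Field Literature.NumberTheory.EllipticCurves
  Literature.NumberTheory.EllipticCurves.ModularForms Literature.NumberTheory.GaloisRepresentations
  Literature.NumberTheory.EllipticCurves.Kato2004 Literature.NumberTheory.EllipticCurves.Kato2004.EulerSystemValues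
  ZpExtension

namespace Literature.NumberTheory.EllipticCurves.Kobayashi2003

/-! ## §1 The hypothesis structure with the print-exact Poitou–Tate field -/

/-- **Kobayashi's Coleman / Poitou–Tate data for the sign `ε` at the trivial character, with Kato's zeta
submodule, on pinned objects — PRINT-EXACT Poitou–Tate field.** VERBATIM the sibling
`SignedColemanKatoData W p f ϖ κ γ ε I` (same parameters: globally minimal elliptic `W/ℚ`, `p`, newform
`f`, period ratio `ϖ`, cyclotomic `(κ, γ)`, sign `ε`, Kato's pinned `I : Kato2004.IwasawaH1Data W p κ γ`
with `T = conj_γ − 1`, covariant, `1 + T ↦ γ`; same fields `col`, `col_injective`, `Z`, `zeta_le_span`,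
`image_zeta_localized`), EXCEPT the field `exact` = (7.21) with (6.13)/(6.14) composed in, which here
quantifies over the dual data with their CONTRAGREDIENT `Λ`-structure — `D : SignedSelmerDualData W κ γ⁻¹ ε`
(`X^ε(E/ℚ_∞)`, `T` acting as `x ↦ x ∘ conj_{γ⁻¹} − x`) and `Y : W.FineSelmerDualData κ γ⁻¹` (`X₀(E/ℚ_∞)`,
likewise) — the structure Poitou–Tate duality carries to the natural action, for which the printed
sequence `𝐇¹ →^{col} Λ → X^ε → X⁰ → 0` consists of `Λ`-LINEAR maps (flag `Kob03-721-dual-action`; the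
sibling's `exact`, with `γ` there, is the printed sequence composed with `ι` out of `Λ`, i.e. it holds
as printed iff `col(𝐇¹)` is `ι`-symmetric — unprinted). Nothing asserted by the structure.
[cite: Kobayashi2003, Thm. 6.2 (6.13)–(6.14) and Thm. 6.3 (p. 11), Thm. 7.3 i) (7.21) and proof of Thm. 7.4 (p. 13), (7.17)–(7.20) and Prop. 7.1 (p. 12), Def. 2.1 (p. 5), Thm. 5.2 iv) and Remark 5.3 i) (pp. 9–10)]
[cite: Kato2004Asterisque, Thm. 12.6 (p. 222), Ex. 13.3 (p. 225), §12.2 (p. 220), §14.9 (p. 239) and §17.13 (p. 279)]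
[cite: Greenberg1989, §0 pp. 101–102 (the Λ-module S^ι, ι(γ) = γ⁻¹)] -/
structure SignedColemanKatoDataContra (W : WeierstrassCurve ℚ) [W.IsElliptic] (p : ℕ) [Fact p.Prime]
    [ContinuousSMul ℤ_[p] (W.tateModule p)] [Module.Free ℤ_[p] (W.tateModule p)]
    [Module.Finite ℤ_[p] (W.tateModule p)] {N : ℕ} (f : CuspForm (Gamma0 N) 2) (ϖ : ℚ)
    (κ : ZpExtension ℚ p) (γ : absoluteGaloisGroup ℚ) (ε : ℤˣ)
    (I : Kato2004.IwasawaH1Data W p κ γ) where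
  /-- «`Col^ε ∘ loc_p`» on the `Δ`-trivial component: the first arrow of (7.21) (sign `ε`) composed
  with the isomorphism (6.13) (`ε = 1`) resp. (6.14) (`ε = −1`) onto `Λ^Δ = ℤ_p[[X]]` (as in the sibling). -/
  col : I.H →ₗ[IwasawaAlgebra p] IwasawaAlgebra p
  /-- Thm. 7.3 i): `𝐇¹(T) → H¹_Iw(T)/H¹_{Iw,ε}(T)` is injective (as in the sibling). -/
  col_injective : Function.Injective col
  /-- Kato Thm. 12.6: the `Λ`-span `Z ⊂ 𝐇¹(T)` of the `p`-power lines of the integral zeta elements,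
  projected to the `Δ`-trivial component `𝐇¹_Γ(T_pW)` (as in the sibling). -/
  Z : Submodule (IwasawaAlgebra p) I.H
  /-- Kato Thm. 12.6 with Ex. 13.3: `Z` lies in the span of GENUINE integral Euler-system classes
  (as in the sibling). -/
  zeta_le_span : Z ≤ Submodule.span (IwasawaAlgebra p) {s : I.H | Kato2004.IsEulerSystemClass W p κ γ I s}
  /-- Thm. 6.3 (sign `ε`, `η = 1`) read on IDEALS at every height-one prime: `col(Z)` and `(G₁)`,
  `ι G₁ = C(ϖ)·ι L` for the sign-`ε` Pollack function `L` of `f`, agree after localisation at `𝔭`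
  (as in the sibling). -/
  image_zeta_localized : W.HasIrreducibleModPGaloisRep p →
    ∀ (L G₁ : IwasawaAlgebra p), IsSignedPAdicLFunction f p ε L →
      iwasawaToPowerSeries p G₁ = PowerSeries.C ((ϖ : ℚ) : ℚ_[p]) * iwasawaToPowerSeries p L →
      ∀ 𝔭 : PrimeSpectrum (IwasawaAlgebra p), 𝔭.asIdeal.height = 1 →
        ∃ s : IwasawaAlgebra p, s ∉ 𝔭.asIdeal ∧
          s * G₁ ∈ Submodule.map col Z ∧
          ∀ z ∈ Z, s * col z ∈ Ideal.span {G₁}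
  /-- (7.21), sign `ε`, `Δ`-trivial component, with (6.13)/(6.14) composed in, PRINT-EXACT: for every
  dual datum `D` of `Sel^ε(E/ℚ_∞)` and `Y` of `Sel₀(ℚ_∞, E[p^∞])` carrying the CONTRAGREDIENT
  `Λ`-structure (generator argument `γ⁻¹`: `T` acts as `x ↦ x ∘ conj_{γ⁻¹} − x`),
  `𝐇¹ →^{col} Λ → X^ε → X₀ → 0` is exact for SOME `Λ`-linear `Λ → X^ε`, `X^ε → X₀`. -/
  exact : ∀ (D : SignedSelmerDualData W κ γ⁻¹ ε) (Y : W.FineSelmerDualData κ γ⁻¹),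
    ∃ (j : IwasawaAlgebra p →ₗ[IwasawaAlgebra p] D.X) (k : D.X →ₗ[IwasawaAlgebra p] Y.X),
      Function.Exact col j ∧ Function.Exact j k ∧ Function.Surjective k

/-! ## §2 The named fact: the structure is inhabited -/

/-- **Kobayashi 2003, Thm. 6.2 (6.13)/(6.14) + Thm. 6.3 + Thm. 7.3 i) (7.21) at the trivial character
(`F_∞ = ℚ_∞`), with Kato 2004 Thm. 12.6 / Ex. 13.3, on pinned objects — PRINT-EXACT Poitou–Tate
clause.** VERBATIM the sibling `thm62_63_73_signedColemanKato_zeta` (same binders: globally minimal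
`W/ℚ`, structure facts of `T_pW` as instance BINDERS, odd prime `p` of good reduction with `a_p = 0`,
newform `f` of `W` with period ratio `ϖ`, cyclotomic `(κ, γ)` matching the cyclotomic variable, sign
`ε`, pinned `I : Kato2004.IwasawaH1Data W p κ γ`) with conclusion `Nonempty (SignedColemanKatoDataContra
W p f ϖ κ γ ε I)` instead of `Nonempty (SignedColemanKatoData …)`: the data are inhabited by
`Col^ε ∘ loc_p` with (6.13)/(6.14), Kato's Thm. 12.6 submodule, Thm. 6.3 on localized ideals, and the
`Δ`-trivial component of (7.21) — the last for the Pontryagin duals with their contragredient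
`Λ`-structure (generator argument `γ⁻¹`), for which the printed maps are `Λ`-linear (flag
`Kob03-721-dual-action`; the sibling, with `γ` there, is the printed (7.21) composed with `ι` out of
`Λ`, equal to the print only if `col(𝐇¹)` is `ι`-symmetric — unprinted). A CONSTRUCTION fact, weaker
than print (maps existential, `Z` only bounded above), never stronger; nothing asserted; no `_holds`
(size XL); all the sibling's reading flags apply verbatim.
[cite: Kobayashi2003, Thm. 6.2 (6.13)–(6.14) and Thm. 6.3 (p. 11), Thm. 7.3 i) (7.21), Cor. 7.2 and proof of Thm. 7.4 (p. 13), (7.17)–(7.20) and Prop. 7.1 (p. 12), Thm. 5.1 iii), Thm. 5.2 i)/iv) and Remark 5.3 i) (pp. 9–10), Def. 6.1 (p. 10), Def. 1.1 (p. 2), Def. 2.1 (p. 5), Thm. 3.2 and (3.4)–(3.6) (p. 7), §3 (p. 5), §4 (p. 8)]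
[cite: Kato2004Asterisque, Thm. 12.5 (4) and Thm. 12.6 (p. 222), Ex. 13.3 (p. 225), §12.2 (p. 220), §13.8 (p. 228), §14.9 (p. 239), §17.13 (p. 279)]
[cite: GreenbergVatsal2000, §3 (Néron vs canonical period, as used in Kobayashi's proof of Thm. 5.2 iv))]
[cite: Greenberg1989, §0 pp. 101–102 (the Λ-module S^ι)] -/
def thm62_63_73_signedColemanKato_zeta_contra : Prop :=
  ∀ (W : WeierstrassCurve ℚ) [W.IsElliptic] [W.IsGloballyMinimal] (p : ℕ) [Fact p.Prime]
    [ContinuousSMul ℤ_[p] (W.tateModule p)] [Module.Free ℤ_[p] (W.tateModule p)]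
    [Module.Finite ℤ_[p] (W.tateModule p)] {N : ℕ} [NeZero N] (f : CuspForm (Gamma0 N) 2) (ϖ : ℚ)
    (κ : ZpExtension ℚ p) (γ : absoluteGaloisGroup ℚ),
    p ≠ 2 → W.HasGoodReductionAtPrime p → W.frobeniusTrace p = 0 → IsNewformOf W f →
    (ϖ : ℝ) * W.realPeriodRat = plusPeriod f →
    κ.IsCyclotomic → κ.IsTopGenerator γ → IsCyclotomicVariable p γ →
    ∀ (ε : ℤˣ) (I : Kato2004.IwasawaH1Data W p κ γ),
      Nonempty (SignedColemanKatoDataContra W p f ϖ κ γ ε I)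

end Literature.NumberTheory.EllipticCurves.Kobayashi2003

end
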